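import Summits.BirchSwinnertonDyer.BirchSwinnertonDyer.Theorems.PrintCFramBottomClassIndexLawFiveLeFlipRungTwistVehicle
import Summits.BirchSwinnertonDyer.BirchSwinnertonDyer.Theorems.PrintCFramBottomClassIndexLawFiveLeFlipRungFourierMoment
import HarnessLib

set_option autoImplicit false

/-!
# Crux `PrintCFram.BottomClassIndexLawFiveLe` (stmt-BirchSwinnertonDyer-20372), line `eisenstein-resource-bdp-line` (registry v27,
# `stub_flipRung`): THE MODULAR INPUT HALF of the joint modular lemma — the Legendre-class twist `V_σ` of the vehicle as a
# `Γ₁(L₀·q⁴)`-form, its coefficients `𝟙[q ∥ n, J(n/q|q) = σ]·c(n)`, and NF-Q: «class `σ` ≡ 0 (mod p) at `∞` ⟹ EVERY coefficient at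
# EVERY cusp in `p·ℤ̄[1/N]`»
# (cell `bsd-print-cfram`, width seat `bsd-line-cfram-p1-w3` g19; THEOREMS ONLY, `--supports` 20372; BSD is not proved by any of this)

HONEST FRAMING. Nothing here is a statement about elliptic curves or BSD; no registered stub is closed. Items (3)+(5) of seat w4 g19's
modular assembly T7 (HOME/STATUS 2026-08-29T08:13:06Z, split accepted 08:13:48Z), in ONE lemma: for ANY `F₀ : ModularForm (Gamma1 L₀) k`
with RATIONAL q-expansion `c`, an odd prime `q`, `σ = ±1`: the twist `V_σ(z) = q⁻² Σ_{j mod q²} h_σ(j) F₀(z + j/q²)` by seat w6 g9's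
Legendre-class weights `h_σ` (T1, `…FlipRungFourierMoment`, spelled out verbatim — no definition) is a `ModularForm (Gamma1 (L₀ (q²)²)) k`
with that exposed function (T3's `hV`), `coeff n (qExpansion 1 V_σ) = 𝟙[q ∥ n ∧ J(n/q | q) = σ] · c(n)` (w6 g9's cut identity
`sum_legendreClassWeight_mul_stdAddChar_sq`), hence — if `c(n) ∈ p·ℤ̄[1/N]` on that class — every coefficient of `qExpansion 1 V_σ` lies in
`p·ℤ̄[1/N]` and, by NF-Q (`FlipRung.exists_isIntegral_qExpansion_slash_coeff`, T4 §3), so does EVERY coefficient of `qExpansion N (V_σ ∣_k ω₀)`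
for EVERY `ω₀ ∈ SL₂(ℤ)` (`L₀ q⁴ ∣ N`, `3 ≤ N`). CONDITIONAL on the cite-only named fact NF-Q (hypothesis). No new definitions, no named facts,
no `sorry`. beyond-print theorem: NO. BSD is not proved by any of this; no summit statement is proved by this seat.

References: [Shimura1971] Prop. 3.64; [Katz1973] §1.6 Cor. 1.6.2; crux notes `Lines/eisenstein-resource-bdp-line-lead-g14.md` §2.1.
-/

-- summit-side namespace `Summit.BirchSwinnertonDyer.BirchSwinnertonDyer.…` (single-conjunct summit, D-0017 layout)
set_option linter.dupNamespace false

noncomputable section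

namespace Summit.BirchSwinnertonDyer.BirchSwinnertonDyer.Theorems.PrintCFram.FlipRung

open UpperHalfPlane Filter Function Complex CongruenceSubgroup PowerSeries
open scoped MatrixGroups ModularForm Topology Manifold Real NumberTheorySymbols
open Summit.BirchSwinnertonDyer.BirchSwinnertonDyer.Theorems.PrintCFram.CuspGlue

/-! ## §1 The coefficients of the Legendre-class twist -/

/-- **The q-expansion of the Legendre-class twist is the class cut.** For `F₀ : ModularForm (Gamma1 L₀) k`, an odd prime `q`, `σ = ±1` and
w6 g9's weights `h_σ(j) = ((q − 1 or −1) + σ·J(−j | q)·g_q)/2`, the twisted form `V_σ` of `FlipRung.exists_modularForm_twist_coe_eq` has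
`coeff n (qExpansion 1 V_σ) = (if q ∥ n ∧ J(n/q | q) = σ then 1 else 0) · coeff n (qExpansion 1 F₀)`. [cite: Shimura1971, Prop. 3.64] -/
theorem exists_modularForm_legendreTwist {L₀ : ℕ} [NeZero L₀] {k : ℤ} (F₀ : ModularForm (Gamma1 L₀) k) (q : ℕ) [Fact q.Prime]
    (hq2 : q ≠ 2) {σ : ℤ} (hσ : σ = 1 ∨ σ = -1) :
    ∃ V : ModularForm (Gamma1 (L₀ * (q ^ 2) ^ 2)) k,
      (∀ z : ℍ, V z = ((q : ℂ) ^ 2)⁻¹ * ∑ j : ZMod (q ^ 2),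
        (((if (q : ℤ) ∣ (j.val : ℤ) then ((q : ℂ) - 1) else -1) + σ * J(-(j.val : ℤ) | q) *
          gaussSum ((quadraticChar (ZMod q)).ringHomComp (Int.castRingHom ℂ)) (ZMod.stdAddChar (N := q))) / 2) *
          F₀ (((j.val : ℝ) / (q : ℝ) ^ 2) +ᵥ z)) ∧
      ∀ n : ℕ, (qExpansion 1 ⇑V).coeff n =
        (if (q : ℤ) ∣ (n : ℤ) ∧ ¬ (q : ℤ) ^ 2 ∣ (n : ℤ) ∧ J((n : ℤ) / q | q) = σ then 1 else 0) * (qExpansion 1 ⇑F₀).coeff n := by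
  haveI : NeZero (q ^ 2) := ⟨pow_ne_zero 2 (Nat.Prime.ne_zero Fact.out)⟩
  obtain ⟨V, hV, hc⟩ := exists_modularForm_twist_coe_eq F₀ q fun j : ZMod (q ^ 2) ↦
    ((if (q : ℤ) ∣ (j.val : ℤ) then ((q : ℂ) - 1) else -1) + σ * J(-(j.val : ℤ) | q) *
      gaussSum ((quadraticChar (ZMod q)).ringHomComp (Int.castRingHom ℂ)) (ZMod.stdAddChar (N := q))) / 2
  refine ⟨V, hV, fun n ↦ ?_⟩
  rw [hc n, ← sum_legendreClassWeight_mul_stdAddChar_sq q hq2 hσ (n : ℤ), Finset.mul_sum]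
  congr 1
  refine Finset.sum_congr rfl fun j _ ↦ ?_
  rw [Int.cast_natCast]
  ring

/-! ## §2 THE MODULAR INPUT HALF: class `σ` ≡ 0 (mod p) at `∞` ⟹ every coefficient at every cusp in `p·ℤ̄[1/N]` -/

/-- **THE MODULAR INPUT HALF (items (3)+(5) of the modular assembly).** NF-Q; `F₀ : ModularForm (Gamma1 L₀) k` with rational q-expansion
`c`; `q` an odd prime, `σ = ±1`; `L₀ q⁴ ∣ N`, `3 ≤ N`. If `c(n) ∈ p·ℤ̄[1/N]` for every `n` with `q ∥ n` and `J(n/q | q) = σ`, then the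
Legendre-class twist `V_σ` (a `ModularForm (Gamma1 (L₀ (q²)²)) k` with T3's `hV` as its function) has EVERY coefficient of
`qExpansion N (V_σ ∣_k ω₀)` in `p·ℤ̄[1/N]`, for EVERY `ω₀ ∈ SL₂(ℤ)`. CONDITIONAL on NF-Q (hypothesis). [cite: Katz1973, §1.6 Cor. 1.6.2] -/
theorem exists_twist_forall_coeff_slash_mem
    (hKatz : Literature.NumberTheory.ModularForms.Katz1973_qExpansionPrinciple_allCusps)
    {L₀ : ℕ} [NeZero L₀] {k : ℤ} (F₀ : ModularForm (Gamma1 L₀) k) (q : ℕ) [Fact q.Prime] (hq2 : q ≠ 2)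
    {σ : ℤ} (hσ : σ = 1 ∨ σ = -1) {p N : ℕ} (hN : L₀ * (q ^ 2) ^ 2 ∣ N) (hN3 : 3 ≤ N)
    {c : ℕ → ℚ} (hc : ∀ n : ℕ, (qExpansion 1 ⇑F₀).coeff n = ((c n : ℚ) : ℂ))
    (hcl : ∀ n : ℕ, (q : ℤ) ∣ (n : ℤ) → ¬ (q : ℤ) ^ 2 ∣ (n : ℤ) → J((n : ℤ) / q | q) = σ →
      ∃ y : ℂ, (∃ j : ℕ, IsIntegral ℤ ((N : ℂ) ^ j * y)) ∧ ((c n : ℚ) : ℂ) = (p : ℂ) * y) :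
    ∃ V : ModularForm (Gamma1 (L₀ * (q ^ 2) ^ 2)) k,
      (∀ z : ℍ, V z = ((q : ℂ) ^ 2)⁻¹ * ∑ j : ZMod (q ^ 2),
        (((if (q : ℤ) ∣ (j.val : ℤ) then ((q : ℂ) - 1) else -1) + σ * J(-(j.val : ℤ) | q) *
          gaussSum ((quadraticChar (ZMod q)).ringHomComp (Int.castRingHom ℂ)) (ZMod.stdAddChar (N := q))) / 2) *
          F₀ (((j.val : ℝ) / (q : ℝ) ^ 2) +ᵥ z)) ∧
      (∀ n : ℕ, (qExpansion 1 ⇑V).coeff n =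
        (if (q : ℤ) ∣ (n : ℤ) ∧ ¬ (q : ℤ) ^ 2 ∣ (n : ℤ) ∧ J((n : ℤ) / q | q) = σ then 1 else 0) * ((c n : ℚ) : ℂ)) ∧
      ∀ (ω₀ : SL(2, ℤ)) (K : ℕ), ∃ y : ℂ, (∃ j : ℕ, IsIntegral ℤ ((N : ℂ) ^ j * y)) ∧
        (qExpansion N (⇑V ∣[k] ω₀)).coeff K = (p : ℂ) * y := by
  obtain ⟨V, hV, hcoefV⟩ := exists_modularForm_legendreTwist F₀ q hq2 hσ
  have hcoefV' : ∀ n : ℕ, (qExpansion 1 ⇑V).coeff n =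
      (if (q : ℤ) ∣ (n : ℤ) ∧ ¬ (q : ℤ) ^ 2 ∣ (n : ℤ) ∧ J((n : ℤ) / q | q) = σ then 1 else 0) * ((c n : ℚ) : ℂ) := fun n ↦ by
    rw [hcoefV n, hc n]
  have hite : ∀ n : ℕ, (qExpansion 1 ⇑V).coeff n =
      if (q : ℤ) ∣ (n : ℤ) ∧ ¬ (q : ℤ) ^ 2 ∣ (n : ℤ) ∧ J((n : ℤ) / q | q) = σ then ((c n : ℚ) : ℂ) else 0 := fun n ↦ by
    rw [hcoefV' n]; split_ifs <;> simp
  have hcoef := forall_coeff_ite_mem (A := qExpansion 1 ⇑V) hite fun n hn ↦ hcl n hn.1 hn.2.1 hn.2.2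
  exact ⟨V, hV, hcoefV', fun ω₀ K ↦ exists_isIntegral_qExpansion_slash_coeff hKatz hN hN3 V p hcoef ω₀ K⟩

/-- **The class clause phrased over `ℕ`** (the (JML⁶) side writes `q ∣ n → ¬ q^2 ∣ n → J(((n / q : ℕ) : ℤ) | q) = σ`): it implies the
`ℤ`-phrased clause used above. [folklore] -/
theorem classClause_int_of_nat {q : ℕ} {σ : ℤ} {P : ℕ → Prop}
    (h : ∀ n : ℕ, q ∣ n → ¬ q ^ 2 ∣ n → J(((n / q : ℕ) : ℤ) | q) = σ → P n) :
    ∀ n : ℕ, (q : ℤ) ∣ (n : ℤ) → ¬ (q : ℤ) ^ 2 ∣ (n : ℤ) → J((n : ℤ) / q | q) = σ → P n := by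
  intro n h1 h2 h3
  refine h n (Int.natCast_dvd_natCast.mp h1) (fun h' ↦ h2 (by exact_mod_cast h')) ?_
  rwa [Int.natCast_div] 

/-- **THE MODULAR INPUT HALF, (JML⁶)-phrased class clause** (over `ℕ`, `J(((n/q : ℕ) : ℤ) | q) = σ`). CONDITIONAL on NF-Q (hypothesis).
[cite: Katz1973, §1.6 Cor. 1.6.2] -/
theorem exists_twist_forall_coeff_slash_mem_nat
    (hKatz : Literature.NumberTheory.ModularForms.Katz1973_qExpansionPrinciple_allCusps)
    {L₀ : ℕ} [NeZero L₀] {k : ℤ} (F₀ : ModularForm (Gamma1 L₀) k) (q : ℕ) [Fact q.Prime] (hq2 : q ≠ 2)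
    {σ : ℤ} (hσ : σ = 1 ∨ σ = -1) {p N : ℕ} (hN : L₀ * (q ^ 2) ^ 2 ∣ N) (hN3 : 3 ≤ N)
    {c : ℕ → ℚ} (hc : ∀ n : ℕ, (qExpansion 1 ⇑F₀).coeff n = ((c n : ℚ) : ℂ))
    (hcl : ∀ n : ℕ, q ∣ n → ¬ q ^ 2 ∣ n → J(((n / q : ℕ) : ℤ) | q) = σ →
      ∃ y : ℂ, (∃ j : ℕ, IsIntegral ℤ ((N : ℂ) ^ j * y)) ∧ ((c n : ℚ) : ℂ) = (p : ℂ) * y) :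
    ∃ V : ModularForm (Gamma1 (L₀ * (q ^ 2) ^ 2)) k,
      (∀ z : ℍ, V z = ((q : ℂ) ^ 2)⁻¹ * ∑ j : ZMod (q ^ 2),
        (((if (q : ℤ) ∣ (j.val : ℤ) then ((q : ℂ) - 1) else -1) + σ * J(-(j.val : ℤ) | q) *
          gaussSum ((quadraticChar (ZMod q)).ringHomComp (Int.castRingHom ℂ)) (ZMod.stdAddChar (N := q))) / 2) *
          F₀ (((j.val : ℝ) / (q : ℝ) ^ 2) +ᵥ z)) ∧
      (∀ n : ℕ, (qExpansion 1 ⇑V).coeff n =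
        (if (q : ℤ) ∣ (n : ℤ) ∧ ¬ (q : ℤ) ^ 2 ∣ (n : ℤ) ∧ J((n : ℤ) / q | q) = σ then 1 else 0) * ((c n : ℚ) : ℂ)) ∧
      ∀ (ω₀ : SL(2, ℤ)) (K : ℕ), ∃ y : ℂ, (∃ j : ℕ, IsIntegral ℤ ((N : ℂ) ^ j * y)) ∧
        (qExpansion N (⇑V ∣[k] ω₀)).coeff K = (p : ℂ) * y :=
  exists_twist_forall_coeff_slash_mem hKatz F₀ q hq2 hσ hN hN3 hc (classClause_int_of_nat hcl)


/-! ## §3 The at-`∞` form (APPENDED on seat w4 g19's reshape request 08:16:15Z): membership of EVERY coefficient of `qExpansion 1 V_σ` -/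

/-- **THE MODULAR INPUT HALF, AT `∞`.** For `F₀ : ModularForm (Gamma1 L₀) k` with rational q-expansion `c`, an odd prime `q`, `σ = ±1`, and
ANY `N p`: if `c(n) ∈ p·ℤ̄[1/N]` for every `n` with `q ∣ n`, `q² ∤ n`, `J(n/q | q) = σ` (ℕ-phrased, as in (JML⁶)), then the Legendre-class twist
`V_σ` (T3's `hV` with `h := h_σ`) has EVERY coefficient of `qExpansion 1 V_σ` in `p·ℤ̄[1/N]` (the other coefficients are `0` by w6 g9's cut
identity) — the `hcoef` hypothesis of `FlipRung.norm_ratCast_le_inv_of_coeff_eq` / `…_unit_mul`, which call NF-Q themselves. No NF-Q here.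
[cite: Shimura1971, Prop. 3.64] -/
theorem exists_legendreTwist_forall_coeff_mem {L₀ : ℕ} [NeZero L₀] {k : ℤ} (F₀ : ModularForm (Gamma1 L₀) k) (q : ℕ) [Fact q.Prime]
    (hq2 : q ≠ 2) {σ : ℤ} (hσ : σ = 1 ∨ σ = -1) {p N : ℕ} {c : ℕ → ℚ}
    (hc : ∀ n : ℕ, (qExpansion 1 ⇑F₀).coeff n = ((c n : ℚ) : ℂ))
    (hcl : ∀ n : ℕ, q ∣ n → ¬ q ^ 2 ∣ n → J(((n / q : ℕ) : ℤ) | q) = σ →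
      ∃ y : ℂ, (∃ j : ℕ, IsIntegral ℤ ((N : ℂ) ^ j * y)) ∧ ((c n : ℚ) : ℂ) = (p : ℂ) * y) :
    ∃ V : ModularForm (Gamma1 (L₀ * (q ^ 2) ^ 2)) k,
      (∀ z : ℍ, V z = ((q : ℂ) ^ 2)⁻¹ * ∑ j : ZMod (q ^ 2),
        (((if (q : ℤ) ∣ (j.val : ℤ) then ((q : ℂ) - 1) else -1) + σ * J(-(j.val : ℤ) | q) *
          gaussSum ((quadraticChar (ZMod q)).ringHomComp (Int.castRingHom ℂ)) (ZMod.stdAddChar (N := q))) / 2) *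
          F₀ (((j.val : ℝ) / (q : ℝ) ^ 2) +ᵥ z)) ∧
      (∀ n : ℕ, (qExpansion 1 ⇑V).coeff n =
        (if (q : ℤ) ∣ (n : ℤ) ∧ ¬ (q : ℤ) ^ 2 ∣ (n : ℤ) ∧ J((n : ℤ) / q | q) = σ then 1 else 0) * ((c n : ℚ) : ℂ)) ∧
      ∀ n : ℕ, ∃ y : ℂ, (∃ j : ℕ, IsIntegral ℤ ((N : ℂ) ^ j * y)) ∧ (qExpansion 1 ⇑V).coeff n = (p : ℂ) * y := by
  obtain ⟨V, hV, hcoefV⟩ := exists_modularForm_legendreTwist F₀ q hq2 hσ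
  have hcoefV' : ∀ n : ℕ, (qExpansion 1 ⇑V).coeff n =
      (if (q : ℤ) ∣ (n : ℤ) ∧ ¬ (q : ℤ) ^ 2 ∣ (n : ℤ) ∧ J((n : ℤ) / q | q) = σ then 1 else 0) * ((c n : ℚ) : ℂ) := fun n ↦ by
    rw [hcoefV n, hc n]
  have hite : ∀ n : ℕ, (qExpansion 1 ⇑V).coeff n =
      if (q : ℤ) ∣ (n : ℤ) ∧ ¬ (q : ℤ) ^ 2 ∣ (n : ℤ) ∧ J((n : ℤ) / q | q) = σ then ((c n : ℚ) : ℂ) else 0 := fun n ↦ by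
    rw [hcoefV' n]; split_ifs <;> simp
  have hcl' := classClause_int_of_nat hcl
  exact ⟨V, hV, hcoefV', forall_coeff_ite_mem (A := qExpansion 1 ⇑V) hite fun n hn ↦ hcl' n hn.1 hn.2.1 hn.2.2⟩

end Summit.BirchSwinnertonDyer.BirchSwinnertonDyer.Theorems.PrintCFram.FlipRung

end
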